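import Summits.CriticalPhenomena.PercolationContinuityZ3.Theorems.PercExchangeRateTransportTransportLemmaFence

/-!
# One-sided transport for the crux `SubcritExchangeUniformity` (K⁻, stmt-CriticalPhenomena-16062), line `onesided`:
# the one-sided fence lemma and the FORWARD one-sided upper fence `upperFenceMono`

Percolation-free real analysis (Mathlib + the landed fence engine of `TransportLemma`).
Helper stubs `fence_monotoneOn_lower`, `upperFenceMono` registered on stmt-CriticalPhenomena-16062 (lead c1).
-/

namespace Summit.CriticalPhenomena.PercolationContinuityZ3.Theorems.SubcritExchangeUniformity.TransportMono

open Filter Topology Set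
open Summit.CriticalPhenomena.PercolationContinuityZ3.Theorems.TransportLemma
  (fence_antitoneOn fence_monotoneOn hasDerivWithinAt_along pc_modulus rightContinuity)

/-- **One-sided fence lemma.** Along a curve `γ` on `[s₀,s₁]` where `Θ` is differentiable and nondecreasing in `p`,
if `b s · ∂ₚΘ(γ s,s) ≤ ∂ₜΘ(γ s,s)` and `γ' s + b s ≥ 0`, then `s ↦ Θ (γ s) s` is monotone. -/
theorem fence_monotoneOn_lower : ∀ (Θ : ℝ → ℝ → ℝ) (b γ γ' : ℝ → ℝ) (s₀ s₁ : ℝ), (∀ s ∈ Set.Icc s₀ s₁, DifferentiableAt ℝ (fun x : ℝ × ℝ => Θ x.1 x.2) (γ s, s)) → (∀ t, Monotone (fun p => Θ p t)) → (∀ s ∈ Set.Icc s₀ s₁, HasDerivWithinAt γ (γ' s) (Set.Icc s₀ s₁) s) → (∀ s ∈ Set.Icc s₀ s₁, b s * deriv (fun q => Θ q s) (γ s) ≤ deriv (fun r => Θ (γ s) r) s) → (∀ s ∈ Set.Icc s₀ s₁, 0 ≤ γ' s + b s) → MonotoneOn (fun s => Θ (γ s) s) (Set.Icc s₀ s₁)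 := by
  intro Θ b γ γ' s₀ s₁ hΘ hmono hγ hex hslope
  -- chain rule along the curve `r ↦ (γ r, r)` (fence engine of `TransportLemma`)
  have hD : ∀ s ∈ Icc s₀ s₁, HasDerivWithinAt (fun r => Θ (γ r) r)
      (deriv (fun q => Θ q s) (γ s) * γ' s + deriv (fun r => Θ (γ s) r) s) (Icc s₀ s₁) s :=
    fun s hs => hasDerivWithinAt_along Θ γ (γ' s) (Icc s₀ s₁) s (hΘ s hs) (hγ s hs)
  apply monotoneOn_of_hasDerivWithinAt_nonneg (convex_Icc s₀ s₁)
    (f' := fun s => deriv (fun q => Θ q s) (γ s) * γ' s + deriv (fun r => Θ (γ s) r) s)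
  · exact fun s hs => (hD s hs).continuousWithinAt
  · intro s hs
    rw [interior_Icc] at hs ⊢
    exact (hD s (Ioo_subset_Icc_self hs)).mono Ioo_subset_Icc_self
  · intro s hs
    rw [interior_Icc] at hs
    have hs' : s ∈ Icc s₀ s₁ := Ioo_subset_Icc_self hs
    -- sign bookkeeping: `∂ₚΘ ≥ 0`, `b ∂ₚΘ ≤ ∂ₜΘ`, `γ' + b ≥ 0` ⇒ `∂ₚΘ γ' + ∂ₜΘ ≥ ∂ₚΘ (γ' + b) ≥ 0`
    have hP : 0 ≤ deriv (fun q => Θ q s) (γ s) := (hmono s).deriv_nonneg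
    have h1 := hex s hs'
    have h2 := hslope s hs'
    nlinarith [mul_le_mul_of_nonneg_left h2 hP]

/-- **Forward one-sided upper fence (positivity propagation).** Uniformly in `t₀ ∈ [lo,hi]`:
`pc s ≤ pc t₀ − (a(pc t₀,t₀) − η)(s − t₀)` for `t₀ ≤ s ≤ t₀ + τ(η)`, from the two-sided exchange inequality on the
RIGHT closed collar and the ONE-SIDED lower bound `(a(pc t,t) − η)∂ₚΘ ≤ ∂ₜΘ` on the left `δ(η)`-strip. -/
theorem upperFenceMono : ∀ (Θ : ℕ → ℝ → ℝ → ℝ) (pc : ℝ → ℝ) (a : ℝ → ℝ → ℝ) (lo hi ρ A : ℝ), 0 < lo → lo < hi → hi < 1 → 0 < ρ → (∀ n, ContDiffOn ℝ 1 (fun x : ℝ × ℝ => Θ n x.1 x.2) (Set.Ioo 0 1 ×ˢ Set.Ioo 0 1)) → (∀ n t, Monotone (fun p => Θ n p t)) → (∀ p t, Antitone (fun n => Θ n p t)) → (∀ n p t, 0 ≤ Θ n p t) → (∀ t ∈ Set.Icc lo hi, ρ < pc t ∧ pc t + ρ < 1) → (∀ t ∈ Set.Icc lo hi, ∀ p :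 ℝ, (p < pc t → (⨅ n, Θ n p t) = 0) ∧ (pc t < p → 0 < ⨅ n, Θ n p t)) → (∀ t ∈ Set.Icc lo hi, ∀ p : ℝ, pc t ≤ p → p ≤ pc t + ρ → |a p t| ≤ A) → (∀ η > (0 : ℝ), ∃ ω > (0 : ℝ), ∀ t ∈ Set.Icc lo hi, ∀ t' ∈ Set.Icc lo hi, ∀ p p' : ℝ, pc t ≤ p → p ≤ pc t + ρ → pc t' ≤ p' → p' ≤ pc t' + ρ → |t - t'| ≤ ω → |p - p'| ≤ ω → |a p t - a p' t'| ≤ η) → (∀ κ > (0 : ℝ), ∃ τ > (0 : ℝ), ∀ t ∈ Set.Icc lo hi, ∀ t' ∈ Set.Icc lo hi, |t - t'| ≤ τ → |pc t - pc t'| ≤ κ) → (∀ η > (0 : ℝ), ∃ m : ℕ, ∀ n ≥ m, ∀ t ∈ Set.Icc lo hi, ∀ p : ℝ, pc t ≤ p → p ≤ pc t + ρ → |deriv (fun s => Θ n p s) t - a p t * deriv (fun q => Θ n q t) p| ≤ η * deriv (fun q => Θ n q t) p) → (∀ η > (0 : ℝ), ∃ δ > (0 : ℝ), ∃ m : ℕ,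 ∀ n ≥ m, ∀ t ∈ Set.Icc lo hi, ∀ p : ℝ, pc t - δ ≤ p → p ≤ pc t → (a (pc t) t - η) * deriv (fun q => Θ n q t) p ≤ deriv (fun s => Θ n p s) t) → ∀ η > (0 : ℝ), ∃ τ > (0 : ℝ), ∀ t₀ ∈ Set.Icc lo hi, ∀ s ∈ Set.Icc lo hi, t₀ ≤ s → s ≤ t₀ + τ → pc s ≤ pc t₀ - (a (pc t₀) t₀ - η) * (s - t₀) := by
  intro Θ pc a lo hi ρ A hlo hlohi hhi hρ hC1 hmp hanti hnn hcollar hthr hA hω hτ hexR hexL η hη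
  -- constants of the construction
  have hη2 : (0:ℝ) < η / 2 := by positivity
  obtain ⟨m₁, hm₁⟩ := hexR (η / 2) hη2
  obtain ⟨δ, hδ, m₂, hm₂⟩ := hexL (η / 2) hη2
  obtain ⟨m, hmm₁, hmm₂⟩ : ∃ m : ℕ, m₁ ≤ m ∧ m₂ ≤ m := ⟨max m₁ m₂, le_max_left _ _, le_max_right _ _⟩
  obtain ⟨ω, hω0, hωa⟩ := hω (η / 2) hη2
  have hκ : 0 < min δ ρ := lt_min hδ hρ
  obtain ⟨θ, hθ0, hθω, hθκ⟩ : ∃ θ : ℝ, 0 < θ ∧ θ ≤ ω ∧ θ ≤ min δ ρ / 4 :=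
    ⟨min ω (min δ ρ / 4), lt_min hω0 (by positivity), min_le_left _ _, min_le_right _ _⟩
  obtain ⟨τ₁, hτ₁, hpc1⟩ := hτ θ hθ0
  have hA0 : 0 ≤ A :=
    le_trans (abs_nonneg _) (hA lo ⟨le_rfl, hlohi.le⟩ (pc lo) le_rfl (by linarith))
  obtain ⟨B, hB0, hBA⟩ : ∃ B : ℝ, 0 < B ∧ A + η ≤ B := ⟨A + η + 1, by positivity, by linarith⟩
  obtain ⟨τ, hτ0, hττ₁, hτω, hτB⟩ : ∃ τ : ℝ, 0 < τ ∧ τ ≤ τ₁ ∧ τ ≤ ω ∧ B * τ ≤ θ / 2 := by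
    refine ⟨min τ₁ (min ω (θ / (2 * B))), lt_min hτ₁ (lt_min hω0 (by positivity)),
      min_le_left _ _, le_trans (min_le_right _ _) (min_le_left _ _), ?_⟩
    have h1 : min τ₁ (min ω (θ / (2 * B))) ≤ θ / (2 * B) :=
      le_trans (min_le_right _ _) (min_le_right _ _)
    calc B * min τ₁ (min ω (θ / (2 * B))) ≤ B * (θ / (2 * B)) :=
          mul_le_mul_of_nonneg_left h1 hB0.le
      _ = θ / 2 := by field_simp
  refine ⟨τ, hτ0, ?_⟩
  intro t₀ ht₀ s hs ht₀s hsτ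
  rcases eq_or_lt_of_le ht₀s with heq | hlt
  · subst heq
    simp
  -- from now on `t₀ < s`; generic tools
  have bdd : ∀ q r, BddBelow (Set.range fun n => Θ n q r) := fun q r =>
    ⟨0, by rintro _ ⟨n, rfl⟩; exact hnn n q r⟩
  have infle : ∀ q r q' r', (∀ n ≥ m, Θ n q r ≤ Θ n q' r') →
      (⨅ n, Θ n q r) ≤ ⨅ n, Θ n q' r' := by
    intro q r q' r' h
    refine le_ciInf fun N => ?_
    calc (⨅ n, Θ n q r) ≤ Θ (max N m) q r := ciInf_le (bdd q r) _
      _ ≤ Θ (max N m) q' r' := h _ (le_max_right _ _)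
      _ ≤ Θ N q' r' := hanti q' r' (le_max_left _ _)
  have hsq : IsOpen (Set.Ioo (0:ℝ) 1 ×ˢ Set.Ioo (0:ℝ) 1) := isOpen_Ioo.prod isOpen_Ioo
  have ha₀ : |a (pc t₀) t₀| ≤ A := hA t₀ ht₀ (pc t₀) le_rfl (by linarith)
  have hδρ1 : min δ ρ ≤ δ := min_le_left _ _
  have hδρ2 : min δ ρ ≤ ρ := min_le_right _ _
  have hcB : |a (pc t₀) t₀ - η| ≤ B := by
    calc |a (pc t₀) t₀ - η| ≤ |a (pc t₀) t₀| + |η| := abs_sub _ _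
      _ ≤ B := by rw [abs_of_pos hη]; linarith
  have hIcc : Set.Icc t₀ s ⊆ Set.Icc lo hi := Set.Icc_subset_Icc ht₀.1 hs.2
  have hrt : ∀ r ∈ Set.Icc t₀ s, |r - t₀| ≤ τ := by
    intro r hr
    rw [abs_of_nonneg (by linarith [hr.1])]
    linarith [hr.2]
  -- facts along a straight segment r ↦ p₀ - c (r - t₀), |p₀ - pc t₀| = ε < θ/2, |c| ≤ B:
  -- it stays in the strip `pc r - δ ≤ · ≤ pc r + ρ`, inside the open square, `ω`-close to `pc t₀`,
  -- and `pc r` stays `ω`-close to `pc t₀`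
  have seg : ∀ (ε c : ℝ), 0 < ε → ε < θ / 2 → |c| ≤ B →
      ∀ r ∈ Set.Icc lo hi, |r - t₀| ≤ τ →
        (pc r - δ ≤ pc t₀ + ε - c * (r - t₀) ∧ pc t₀ + ε - c * (r - t₀) ≤ pc r + ρ) ∧
        (pc t₀ + ε - c * (r - t₀) ∈ Set.Ioo (0:ℝ) 1 ∧ r ∈ Set.Ioo (0:ℝ) 1) ∧
        |pc t₀ + ε - c * (r - t₀) - pc t₀| ≤ ω ∧ |pc r - pc t₀| ≤ ω := by
    intro ε c hε hεθ hcB r hr hrt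
    have h1 : |pc t₀ + ε - c * (r - t₀) - pc t₀| ≤ θ := by
      have e : pc t₀ + ε - c * (r - t₀) - pc t₀ = ε - c * (r - t₀) := by ring
      rw [e]
      have hct : |c| * |r - t₀| ≤ B * τ :=
        mul_le_mul hcB hrt (abs_nonneg _) hB0.le
      calc |ε - c * (r - t₀)| ≤ |ε| + |c * (r - t₀)| := abs_sub _ _
        _ = ε + |c| * |r - t₀| := by rw [abs_of_pos hε, abs_mul]
        _ ≤ θ := by linarith
    have h2 : |pc r - pc t₀| ≤ θ := hpc1 r hr t₀ ht₀ (hrt.trans hττ₁)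
    have h3 : |pc t₀ + ε - c * (r - t₀) - pc r| ≤ min δ ρ / 2 := by
      have e : pc t₀ + ε - c * (r - t₀) - pc r
          = (pc t₀ + ε - c * (r - t₀) - pc t₀) - (pc r - pc t₀) := by ring
      rw [e]
      calc |(pc t₀ + ε - c * (r - t₀) - pc t₀) - (pc r - pc t₀)|
          ≤ |pc t₀ + ε - c * (r - t₀) - pc t₀| + |pc r - pc t₀| := abs_sub _ _
        _ ≤ θ + θ := by linarith
        _ ≤ min δ ρ / 2 := by linarith
    obtain ⟨h3a, h3b⟩ := abs_le.1 h3
    obtain ⟨hc1, hc2⟩ := hcollar r hr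
    exact ⟨⟨by linarith, by linarith⟩,
      ⟨⟨by linarith, by linarith⟩, ⟨by linarith [hr.1], by linarith [hr.2]⟩⟩, h1.trans hθω, h2.trans hθω⟩
  -- THE POINTWISE ONE-SIDED BOUND along the forward segment of slope -(a₀ - η), for n ≥ m:
  -- above the curve from the two-sided exchange inequality, below it from the one-sided bound,
  -- in both cases combined with the uniform modulus of `a` on the right closed collar
  have ptw : ∀ ε : ℝ, 0 < ε → ε < θ / 2 → ∀ n ≥ m, ∀ r ∈ Set.Icc t₀ s,
      (a (pc t₀) t₀ - η) * deriv (fun q => Θ n q r) (pc t₀ + ε - (a (pc t₀) t₀ - η) * (r - t₀))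
        ≤ deriv (fun x => Θ n (pc t₀ + ε - (a (pc t₀) t₀ - η) * (r - t₀)) x) r := by
    intro ε hε hεθ n hn r hr
    have hr' : r ∈ Set.Icc lo hi := hIcc hr
    obtain ⟨⟨hF1, hF2⟩, -, hF4, hF5⟩ := seg ε (a (pc t₀) t₀ - η) hε hεθ hcB r hr' (hrt r hr)
    have hP : 0 ≤ deriv (fun q => Θ n q r) (pc t₀ + ε - (a (pc t₀) t₀ - η) * (r - t₀)) :=
      (hmp n r).deriv_nonneg
    rcases le_or_gt (pc r) (pc t₀ + ε - (a (pc t₀) t₀ - η) * (r - t₀)) with hcase | hcase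
    · -- on the right closed collar: two-sided exchange inequality with slack η/2
      have h1 := hm₁ n (hmm₁.trans hn) r hr' _ hcase hF2
      have h2 := hωa r hr' t₀ ht₀ _ (pc t₀) hcase hF2 le_rfl (by linarith)
        ((hrt r hr).trans hτω) hF4
      have h3 := (abs_le.1 h1).1
      have h4 := (abs_le.1 h2).1
      nlinarith [mul_le_mul_of_nonneg_left h4 hP]
    · -- strictly below the curve, in the δ-strip: the one-sided bound with slack η/2
      have h1 := hm₂ n (hmm₂.trans hn) r hr' _ hF1 hcase.le
      have h2 := hωa r hr' t₀ ht₀ (pc r) (pc t₀) le_rfl (by linarith) le_rfl (by linarith)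
        ((hrt r hr).trans hτω) hF5
      have h4 := (abs_le.1 h2).1
      nlinarith [mul_le_mul_of_nonneg_left h4 hP]
  -- the claim at every small ε > 0: the forward segment issued from (pc t₀ + ε, t₀) is a fence
  have claim : ∀ ε : ℝ, 0 < ε → ε < θ / 2 →
      pc s ≤ pc t₀ + ε - (a (pc t₀) t₀ - η) * (s - t₀) := by
    intro ε hε hεθ
    have F := fun r (hr : r ∈ Set.Icc t₀ s) =>
      seg ε (a (pc t₀) t₀ - η) hε hεθ hcB r (hIcc hr) (hrt r hr)
    have key : ∀ n ≥ m, Θ n (pc t₀ + ε) t₀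
        ≤ Θ n (pc t₀ + ε - (a (pc t₀) t₀ - η) * (s - t₀)) s := by
      intro n hn
      have hM : MonotoneOn (fun r => Θ n (pc t₀ + ε - (a (pc t₀) t₀ - η) * (r - t₀)) r)
          (Set.Icc t₀ s) :=
        fence_monotoneOn_lower (Θ n) (fun _ => a (pc t₀) t₀ - η)
          (fun r => pc t₀ + ε - (a (pc t₀) t₀ - η) * (r - t₀))
          (fun _ => -(a (pc t₀) t₀ - η)) t₀ s
          (fun r hr => ((hC1 n).differentiableOn one_ne_zero).differentiableAt
            (hsq.mem_nhds (F r hr).2.1))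
          (hmp n)
          (fun r _ => by
            have h := (((hasDerivAt_id r).sub_const t₀).const_mul
              (a (pc t₀) t₀ - η)).const_sub (pc t₀ + ε)
            simpa using h.hasDerivWithinAt)
          (fun r hr => ptw ε hε hεθ n hn r hr)
          (fun _ _ => by simp)
      have h1 := hM (Set.left_mem_Icc.2 hlt.le) (Set.right_mem_Icc.2 hlt.le) hlt.le
      simpa using h1
    have hpos : 0 < ⨅ n, Θ n (pc t₀ + ε) t₀ := (hthr t₀ ht₀ (pc t₀ + ε)).2 (by linarith)
    have hpos' : 0 < ⨅ n, Θ n (pc t₀ + ε - (a (pc t₀) t₀ - η) * (s - t₀)) s :=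
      lt_of_lt_of_le hpos (infle _ _ _ _ key)
    by_contra hcon
    push Not at hcon
    have h0 := (hthr s hs _).1 hcon
    linarith
  -- ε ↓ 0
  have hmain : pc s + (a (pc t₀) t₀ - η) * (s - t₀) ≤ pc t₀ := by
    apply le_of_forall_pos_le_add
    intro ε hε
    have h := claim (min ε (θ / 4)) (lt_min hε (by positivity))
      (lt_of_le_of_lt (min_le_right _ _) (by linarith))
    linarith [min_le_left ε (θ / 4)]
  linarith

end Summit.CriticalPhenomena.PercolationContinuityZ3.Theorems.SubcritExchangeUniformity.TransportMono
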